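import Summits.HubbardSuperconductivity.HubbardSuperconductivity.Theorems.BalabanIRBirEveryGroundStateThermalChordCore
import Literature.MathematicalPhysics.QuantumLattice.SectorSpectrum
import HarnessLib

/-!
# Route `BalabanIR`, crux 5 `BirEveryGroundState` (`stmt-HubbardSuperconductivity-2083`):
# the Peierls–Bogoliubov inequality in a sector — thermal form of the conjugate-source shift

Finite-dimensional core of the ENGINE-FACING form of "shifted average ⇒ every ground state". For
Hermitian `H`, `Y`, a subspace `K ≤ ℂⁿ` invariant under both (a symmetry sector) with orthogonal
projection `P_K`, real `κ`, `β`, and the penalised matrix `X = H + κY`, write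
`Z_K(A) = re tr (P_K e^{-βA})` and `⟨Y⟩ = re tr (P_K e^{-βX} Y) / Z_K(X)` (the sector Gibbs average of
`Y` in the PENALISED ensemble). Then

* `sectorPartitionFn_mul_exp_le` — **`Z_K(X) · e^{βκ⟨Y⟩} ≤ Z_K(H)`**, the Peierls–Bogoliubov
  (Bogoliubov convexity) inequality for the sector-restricted free energy: in the eigenbasis `u_j`
  of `X` the projected vectors `w_j = P_K u_j` are again `X`-eigenvectors (`[P_K, X] = 0`), so
  `Z_K(X) = Σ_j e^{-βλ_j} ‖w_j‖²`, `Z_K(X)⟨Y⟩ = Σ_j e^{-βλ_j} ⟨w_j, Y w_j⟩` and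
  `Z_K(H) = Σ_j ⟨w_j, e^{-βH} w_j⟩ ≥ Σ_j ‖w_j‖² e^{-β⟨ŵ_j, H ŵ_j⟩}` (one-vector Peierls–Bogoliubov,
  `re_dotProduct_self_mul_exp_le_re_gibbsWeight`) with `⟨ŵ_j, H ŵ_j⟩ = λ_j - κ ⟨ŵ_j, Y ŵ_j⟩`; Jensen
  for the Boltzmann weights `e^{-βλ_j} ‖w_j‖² / Z_K(X)` concludes;
* `mul_sectorGibbsAverage_le_log_sub_log` — logarithmic form `βκ⟨Y⟩ ≤ log Z_K(H) - log Z_K(X)`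
  (`K ≠ ⊥`);
* `sectorGibbsAverage_sub_le_re_rayleigh_ground` — with the one-vector bound against the entropy
  budget (`thermalChord_le_re_rayleigh`, companion `…ThermalChordCore`): for `κ, β > 0` and every
  normalised sector ground state `ψ` of `H`,
  **`⟨Y⟩_{β,K,H+κY} - log (dim K) / (βκ) ≤ re ⟨ψ, Y ψ⟩`** — the THERMAL sector average of `Y` in the
  penalised ensemble, at any `β` with `βκ ≫ log dim K`, bounds the `Y`-content of EVERY ground state
  of `H` from below. No genericity, no degeneracy count beyond `log dim K`, no `β → ∞`.

The Hubbard specialisation (thermal shifted average at `β_L ≍ L²/κ` ⇒ every-ground-state `d`-wave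
LRO ⇒ summit) is `BalabanIRBirEveryGroundStateSectorPBHubbard.lean`; the zero-temperature version
of the shift is `BalabanIRBirEveryGroundStateSourceShift(Core).lean`.

This module imports NO route file (rev-5 materialisation rule). Sources: B. Simon, *The Statistical
Mechanics of Lattice Gases* I (1993) §II.13 (Peierls–Bogoliubov, Bogoliubov convexity inequality);
Bratteli–Robinson II §5.3.1; R. B. Griffiths, J. Math. Phys. 5 (1964) 1215 §III; Tasaki (2020) App. A.
Folklore; no definition is introduced.

## Mathlib / tree search

REUSED: `Theorems.exp_neg_mul_rayleigh_le_re_gibbsWeight`, `Theorems.star_mul_mul_apply_self`,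
`Theorems.re_rayleigh_le_re_trace_projMatrix_mul`, `Theorems.thermalChord_le_re_rayleigh`
(`…ThermalChordCore`), `Literature.….trace_gibbsWeight_mul_eq_sum`, `projMatrix_map_commute_of_invariant`,
`projMatrix_map_mulVec_mem`, `projMatrix_map_mulVec_of_mem`, `projMatrix_mul_self`, `exists_smul_unit`;
Mathlib `convexOn_exp.map_sum_le`, `Matrix.IsHermitian.eigenvectorUnitary`. The whole-space
Peierls–Bogoliubov inequality exists (`Literature.….peierls_bogoliubov`,
`log_partitionFn_sub_le_log_partitionFn_add`); the sector-restricted form is new here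
(`lean search "sectorPartitionFn|projMatrix.*gibbsWeight.*exp"`: no hits).
-/

noncomputable section

open scoped Matrix.Norms.L2Operator ComplexOrder MatrixOrder InnerProductSpace

namespace Summit.HubbardSuperconductivity.HubbardSuperconductivity.Theorems

open Matrix Finset Filter Literature.MathematicalPhysics.QuantumLattice

section Abstract

variable {n : Type*} [Fintype n] [DecidableEq n]

/-- **One-vector Peierls–Bogoliubov for a non-normalised vector.** For Hermitian `X`, real `β` and
`v ≠ 0`: `‖v‖² · exp (-β re ⟨v, X v⟩ / ‖v‖²) ≤ re ⟨v, e^{-βX} v⟩` (`‖v‖² = re ⟨v, v⟩`; normalise and use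
`exp_neg_mul_rayleigh_le_re_gibbsWeight`). B. Simon (1993) §II.13. [folklore] -/
theorem re_dotProduct_self_mul_exp_le_re_gibbsWeight {X : Matrix n n ℂ} (hX : X.IsHermitian)
    (β : ℝ) {v : n → ℂ} (hv : v ≠ 0) :
    (star v ⬝ᵥ v).re * Real.exp (-(β * ((star v ⬝ᵥ X *ᵥ v).re / (star v ⬝ᵥ v).re))) ≤
      (star v ⬝ᵥ gibbsWeight β X *ᵥ v).re := by
  obtain ⟨a, -, hunit⟩ := exists_smul_unit hv
  have hcc : star a * a = ((‖a‖ ^ 2 : ℝ) : ℂ) := by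
    rw [Complex.star_def, Complex.conj_mul']
    push_cast
    rfl
  have hsc : ∀ M : Matrix n n ℂ,
      (star (a • v) ⬝ᵥ M *ᵥ (a • v)).re = ‖a‖ ^ 2 * (star v ⬝ᵥ M *ᵥ v).re := by
    intro M
    rw [mulVec_smul, star_smul, smul_dotProduct, dotProduct_smul, smul_smul, hcc, smul_eq_mul,
      Complex.re_ofReal_mul]
  have h1 : ‖a‖ ^ 2 * (star v ⬝ᵥ v).re = 1 := by
    have h := congrArg Complex.re hunit
    rwa [star_smul, smul_dotProduct, dotProduct_smul, smul_smul, hcc, smul_eq_mul,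
      Complex.re_ofReal_mul, Complex.one_re] at h
  have hr : 0 < (star v ⬝ᵥ v).re := (Complex.pos_iff.mp (dotProduct_star_self_pos_iff.2 hv)).1
  have key := exp_neg_mul_rayleigh_le_re_gibbsWeight hX β hunit
  rw [hsc, hsc] at key
  have hX' : ‖a‖ ^ 2 * (star v ⬝ᵥ X *ᵥ v).re = (star v ⬝ᵥ X *ᵥ v).re / (star v ⬝ᵥ v).re := by
    rw [eq_div_iff hr.ne']
    calc ‖a‖ ^ 2 * (star v ⬝ᵥ X *ᵥ v).re * (star v ⬝ᵥ v).re
        = ‖a‖ ^ 2 * (star v ⬝ᵥ v).re * (star v ⬝ᵥ X *ᵥ v).re := by ring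
      _ = (star v ⬝ᵥ X *ᵥ v).re := by rw [h1, one_mul]
  rw [hX'] at key
  calc (star v ⬝ᵥ v).re * Real.exp (-(β * ((star v ⬝ᵥ X *ᵥ v).re / (star v ⬝ᵥ v).re)))
      ≤ (star v ⬝ᵥ v).re * (‖a‖ ^ 2 * (star v ⬝ᵥ gibbsWeight β X *ᵥ v).re) :=
        mul_le_mul_of_nonneg_left key hr.le
    _ = ‖a‖ ^ 2 * (star v ⬝ᵥ v).re * (star v ⬝ᵥ gibbsWeight β X *ᵥ v).re := by ring
    _ = (star v ⬝ᵥ gibbsWeight β X *ᵥ v).re := by rw [h1, one_mul]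

/-- **THE PEIERLS–BOGOLIUBOV INEQUALITY IN A SECTOR.** `H`, `Y` Hermitian, `K` a subspace invariant
under both, `P_K` its orthogonal projection, `κ, β ∈ ℝ`, `X = H + κY`. Then
`re tr (P_K e^{-βX}) · exp (βκ · re tr (P_K e^{-βX} Y) / re tr (P_K e^{-βX})) ≤ re tr (P_K e^{-βH})`,
i.e. `log Z_K(H) - log Z_K(H + κY) ≥ βκ ⟨Y⟩_{β,K,H+κY}` (supporting line of the convex function
`κ ↦ log Z_K(H + κY)` at the endpoint). Proof: eigenbasis `u_j` of `X` (eigenvalues `λ_j`), projected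
vectors `w_j = P_K u_j` (again `λ_j`-eigenvectors since `[P_K, X] = 0`); then
`Z_K(X) = Σ_j e^{-βλ_j} ‖w_j‖²`, `re tr (P_K e^{-βX} Y) = Σ_j e^{-βλ_j} re ⟨w_j, Y w_j⟩`,
`Z_K(H) = Σ_j re ⟨w_j, e^{-βH} w_j⟩`, the one-vector bound
`re ⟨w_j, e^{-βH} w_j⟩ ≥ ‖w_j‖² e^{-βλ_j + βκ re⟨w_j, Y w_j⟩/‖w_j‖²}` and Jensen for `exp` with the
Boltzmann weights `e^{-βλ_j}‖w_j‖² / Z_K(X)`. B. Simon (1993) §II.13, Thm II.13.3 (whole space);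
Bratteli–Robinson II §5.3.1. [folklore] -/
theorem sectorPartitionFn_mul_exp_le {H Y : Matrix n n ℂ} (hH : H.IsHermitian)
    (hY : Y.IsHermitian) (K : Submodule ℂ (n → ℂ)) (hinvH : ∀ v ∈ K, H *ᵥ v ∈ K)
    (hinvY : ∀ v ∈ K, Y *ᵥ v ∈ K) (κ β : ℝ) :
    (projMatrix (K.map ((WithLp.linearEquiv 2 ℂ (n → ℂ)).symm :
        (n → ℂ) →ₗ[ℂ] EuclideanSpace ℂ n)) * gibbsWeight β (H + (κ : ℂ) • Y)).trace.re *
      Real.exp (β * κ *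
        ((projMatrix (K.map ((WithLp.linearEquiv 2 ℂ (n → ℂ)).symm :
            (n → ℂ) →ₗ[ℂ] EuclideanSpace ℂ n)) * gibbsWeight β (H + (κ : ℂ) • Y) * Y).trace.re /
          (projMatrix (K.map ((WithLp.linearEquiv 2 ℂ (n → ℂ)).symm :
            (n → ℂ) →ₗ[ℂ] EuclideanSpace ℂ n)) * gibbsWeight β (H + (κ : ℂ) • Y)).trace.re)) ≤
      (projMatrix (K.map ((WithLp.linearEquiv 2 ℂ (n → ℂ)).symm :
        (n → ℂ) →ₗ[ℂ] EuclideanSpace ℂ n)) * gibbsWeight β H).trace.re := by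
  set P := projMatrix (K.map ((WithLp.linearEquiv 2 ℂ (n → ℂ)).symm :
    (n → ℂ) →ₗ[ℂ] EuclideanSpace ℂ n)) with hP
  set X : Matrix n n ℂ := H + (κ : ℂ) • Y with hXdef
  have hXh : X.IsHermitian :=
    hH.add (hY.smul (by rw [isSelfAdjoint_iff, Complex.star_def, Complex.conj_ofReal]))
  have hinvX : ∀ v ∈ K, X *ᵥ v ∈ K := by
    intro v hv
    rw [hXdef, add_mulVec, smul_mulVec]
    exact K.add_mem (hinvH v hv) (K.smul_mem _ (hinvY v hv))
  -- the projection
  have hPH : Pᴴ = P := (projMatrix_isHermitian _).eq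
  have hPP : P * P = P := projMatrix_mul_self _
  have hPX : P * X = X * P := projMatrix_map_commute_of_invariant hXh K hinvX
  -- the eigenbasis of `X`
  set U : Matrix n n ℂ := (hXh.eigenvectorUnitary : Matrix n n ℂ) with hU
  have hUm : U ∈ unitary (Matrix n n ℂ) := hXh.eigenvectorUnitary.prop
  have hcol : ∀ j, X *ᵥ (fun i => U i j) = ((hXh.eigenvalues j : ℝ) : ℂ) • (fun i => U i j) := by
    intro j
    have h : (fun i => U i j) = ⇑(hXh.eigenvectorBasis j) :=
      funext fun i => IsHermitian.eigenvectorUnitary_apply hXh i j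
    rw [h, hXh.mulVec_eigenvectorBasis j, RCLike.real_smul_eq_coe_smul (K := ℂ)]
    rfl
  -- the projected eigenvectors `w_j = P u_j` are `λ_j`-eigenvectors of `X` in `K`
  have hwK : ∀ j, P *ᵥ (fun i => U i j) ∈ K := fun j => projMatrix_map_mulVec_mem K _
  have hXw : ∀ j, X *ᵥ (P *ᵥ fun i => U i j) =
      ((hXh.eigenvalues j : ℝ) : ℂ) • (P *ᵥ fun i => U i j) := by
    intro j
    rw [mulVec_mulVec, ← hPX, ← mulVec_mulVec, hcol, mulVec_smul]
  -- diagonal entries of conjugated matrices as quadratic forms of the `w_j`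
  have hdP : ∀ j, (star U * P * U) j j =
      star (P *ᵥ fun i => U i j) ⬝ᵥ (P *ᵥ fun i => U i j) := by
    intro j
    rw [star_mul_mul_apply_self, star_mulVec, ← dotProduct_mulVec, hPH, mulVec_mulVec, hPP]
  have hdY : ∀ j, (star U * (Y * P) * U) j j =
      star (P *ᵥ fun i => U i j) ⬝ᵥ Y *ᵥ (P *ᵥ fun i => U i j) := by
    intro j
    have hYw : Y *ᵥ (P *ᵥ fun i => U i j) ∈ K := hinvY _ (hwK j)
    rw [star_mul_mul_apply_self, ← mulVec_mulVec, star_mulVec, ← dotProduct_mulVec, hPH,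
      projMatrix_map_mulVec_of_mem K hYw]
  have hdG : ∀ j, (star U * (P * gibbsWeight β H * P) * U) j j =
      star (P *ᵥ fun i => U i j) ⬝ᵥ gibbsWeight β H *ᵥ (P *ᵥ fun i => U i j) := by
    intro j
    rw [star_mul_mul_apply_self, ← mulVec_mulVec, ← mulVec_mulVec, star_mulVec,
      ← dotProduct_mulVec, hPH]
  -- abbreviations for the real quantities
  set ex : n → ℝ := fun j => Real.exp (-β * hXh.eigenvalues j) with hex
  set c : n → ℝ := fun j => (star (P *ᵥ fun i => U i j) ⬝ᵥ (P *ᵥ fun i => U i j)).re with hc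
  set t : n → ℝ := fun j => (star (P *ᵥ fun i => U i j) ⬝ᵥ Y *ᵥ (P *ᵥ fun i => U i j)).re
    with ht
  set g : n → ℝ := fun j =>
    (star (P *ᵥ fun i => U i j) ⬝ᵥ gibbsWeight β H *ᵥ (P *ᵥ fun i => U i j)).re with hg
  -- the three traces as sums
  have hZ : (P * gibbsWeight β X).trace.re = ∑ j, ex j * c j := by
    rw [trace_mul_comm, trace_gibbsWeight_mul_eq_sum hXh β P, Complex.re_sum]
    refine Finset.sum_congr rfl fun j _ => ?_
    rw [← hU, hdP, Complex.re_ofReal_mul]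
  have hT : (P * gibbsWeight β X * Y).trace.re = ∑ j, ex j * t j := by
    rw [trace_mul_cycle, trace_mul_comm, trace_gibbsWeight_mul_eq_sum hXh β (Y * P), Complex.re_sum]
    refine Finset.sum_congr rfl fun j _ => ?_
    rw [← hU, hdY, Complex.re_ofReal_mul]
  have hR : (P * gibbsWeight β H).trace.re = ∑ j, g j := by
    have h3 : (P * gibbsWeight β H * P).trace = (P * gibbsWeight β H).trace := by
      rw [trace_mul_cycle, hPP]
    have h4 : (star U * (P * gibbsWeight β H * P) * U).trace = (P * gibbsWeight β H * P).trace := by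
      rw [trace_mul_cycle, Unitary.mul_star_self_of_mem hUm, Matrix.one_mul]
    rw [← h3, ← h4, Matrix.trace, Complex.re_sum]
    refine Finset.sum_congr rfl fun j _ => ?_
    rw [Matrix.diag_apply, hdG]
  -- elementary facts about `c`, `t`
  have hex0 : ∀ j, 0 < ex j := fun j => Real.exp_pos _
  have hzero : ∀ j, (P *ᵥ fun i => U i j) = 0 → c j = 0 ∧ t j = 0 ∧ g j = 0 := by
    intro j hv
    simp only [hc, ht, hg, hv, star_zero, zero_dotProduct, Complex.zero_re, and_self]
  have hcpos : ∀ j, (P *ᵥ fun i => U i j) ≠ 0 → 0 < c j := fun j hv =>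
    (Complex.pos_iff.mp (dotProduct_star_self_pos_iff.2 hv)).1
  have hc0 : ∀ j, 0 ≤ c j := by
    intro j
    by_cases hv : (P *ᵥ fun i => U i j) = 0
    · exact ((hzero j hv).1).symm.le
    · exact (hcpos j hv).le
  have hct : ∀ j, c j * (t j / c j) = t j := by
    intro j
    by_cases hv : (P *ᵥ fun i => U i j) = 0
    · rw [(hzero j hv).1, (hzero j hv).2.1, zero_mul]
    · exact mul_div_cancel₀ _ (hcpos j hv).ne'
  -- the one-vector Peierls–Bogoliubov bound, term by term
  have hterm : ∀ j, ex j * c j * Real.exp (β * κ * (t j / c j)) ≤ g j := by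
    intro j
    by_cases hv : (P *ᵥ fun i => U i j) = 0
    · rw [(hzero j hv).1, (hzero j hv).2.2, mul_zero, zero_mul]
    have hcj := hcpos j hv
    -- `re ⟨w, X w⟩ = λ c` and `re ⟨w, H w⟩ = λ c - κ t`
    have hXq : (star (P *ᵥ fun i => U i j) ⬝ᵥ X *ᵥ (P *ᵥ fun i => U i j)).re =
        hXh.eigenvalues j * c j := by
      rw [hXw, dotProduct_smul, smul_eq_mul, Complex.re_ofReal_mul]
    have hsplit : (star (P *ᵥ fun i => U i j) ⬝ᵥ X *ᵥ (P *ᵥ fun i => U i j)).re =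
        (star (P *ᵥ fun i => U i j) ⬝ᵥ H *ᵥ (P *ᵥ fun i => U i j)).re + κ * t j := by
      rw [hXdef, add_mulVec, dotProduct_add, Complex.add_re, smul_mulVec, dotProduct_smul,
        smul_eq_mul, Complex.re_ofReal_mul]
    have hHq : (star (P *ᵥ fun i => U i j) ⬝ᵥ H *ᵥ (P *ᵥ fun i => U i j)).re =
        hXh.eigenvalues j * c j - κ * t j := by linarith
    have key := re_dotProduct_self_mul_exp_le_re_gibbsWeight hH β hv
    rw [hHq] at key
    have hcne : c j ≠ 0 := hcj.ne'
    have hexp_arg : -(β * ((hXh.eigenvalues j * c j - κ * t j) / c j)) =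
        -β * hXh.eigenvalues j + β * κ * (t j / c j) := by
      rw [sub_div, mul_div_assoc, div_self hcne, mul_one, mul_div_assoc]
      ring
    have hcq : (star (P *ᵥ fun i => U i j) ⬝ᵥ (P *ᵥ fun i => U i j)).re = c j := rfl
    rw [hcq, hexp_arg, Real.exp_add] at key
    calc ex j * c j * Real.exp (β * κ * (t j / c j))
        = c j * (Real.exp (-β * hXh.eigenvalues j) * Real.exp (β * κ * (t j / c j))) := by
          simp only [hex]; ring
      _ ≤ g j := key
  -- nonnegativity
  have hg0 : ∀ j, 0 ≤ g j := fun j =>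
    (mul_nonneg (mul_nonneg (hex0 j).le (hc0 j)) (Real.exp_pos _).le).trans (hterm j)
  have hZ0 : 0 ≤ ∑ j, ex j * c j := Finset.sum_nonneg fun j _ => mul_nonneg (hex0 j).le (hc0 j)
  rw [hZ, hT, hR]
  rcases hZ0.eq_or_lt with hZe | hZp
  · -- empty sector: both sides trivial
    rw [← hZe, zero_mul]
    exact Finset.sum_nonneg fun j _ => hg0 j
  · -- Jensen for the Boltzmann weights `ex j * c j / Z`
    set Z : ℝ := ∑ j, ex j * c j with hZdef
    have hw0 : ∀ j ∈ (univ : Finset n), 0 ≤ ex j * c j / Z :=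
      fun j _ => div_nonneg (mul_nonneg (hex0 j).le (hc0 j)) hZp.le
    have hw1 : ∑ j, ex j * c j / Z = 1 := by
      rw [← Finset.sum_div, div_self hZp.ne']
    have hJ := (convexOn_exp).map_sum_le (t := (univ : Finset n)) (w := fun j => ex j * c j / Z)
      (p := fun j => β * κ * (t j / c j)) hw0 hw1 (fun j _ => Set.mem_univ _)
    simp only [smul_eq_mul] at hJ
    have hmean : ∑ j, ex j * c j / Z * (β * κ * (t j / c j)) = β * κ * ((∑ j, ex j * t j) / Z) := by
      rw [Finset.sum_div, Finset.mul_sum]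
      refine Finset.sum_congr rfl fun j _ => ?_
      calc ex j * c j / Z * (β * κ * (t j / c j)) = β * κ * (ex j * (c j * (t j / c j)) / Z) := by
            ring
        _ = β * κ * (ex j * t j / Z) := by rw [hct]
    rw [hmean] at hJ
    calc Z * Real.exp (β * κ * ((∑ j, ex j * t j) / Z))
        ≤ Z * ∑ j, ex j * c j / Z * Real.exp (β * κ * (t j / c j)) :=
          mul_le_mul_of_nonneg_left hJ hZp.le
      _ = ∑ j, ex j * c j * Real.exp (β * κ * (t j / c j)) := by
          rw [Finset.mul_sum]
          refine Finset.sum_congr rfl fun j _ => ?_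
          field_simp
      _ ≤ ∑ j, g j := Finset.sum_le_sum fun j _ => hterm j

/-- **Logarithmic form**: for `K ≠ ⊥`, `βκ · ⟨Y⟩_{β,K,H+κY} ≤ log Z_K(H) - log Z_K(H + κY)`, where
`Z_K(A) = re tr (P_K e^{-βA}) > 0` and `⟨Y⟩_{β,K,H+κY} = re tr (P_K e^{-β(H+κY)} Y) / Z_K(H + κY)`
(`sectorPartitionFn_mul_exp_le`, monotonicity of `log`). B. Simon (1993) §II.13. [folklore] -/
theorem mul_sectorGibbsAverage_le_log_sub_log {H Y : Matrix n n ℂ} (hH : H.IsHermitian)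
    (hY : Y.IsHermitian) (K : Submodule ℂ (n → ℂ)) (hK : K ≠ ⊥) (hinvH : ∀ v ∈ K, H *ᵥ v ∈ K)
    (hinvY : ∀ v ∈ K, Y *ᵥ v ∈ K) (κ β : ℝ) :
    β * κ *
        ((projMatrix (K.map ((WithLp.linearEquiv 2 ℂ (n → ℂ)).symm :
            (n → ℂ) →ₗ[ℂ] EuclideanSpace ℂ n)) * gibbsWeight β (H + (κ : ℂ) • Y) * Y).trace.re /
          (projMatrix (K.map ((WithLp.linearEquiv 2 ℂ (n → ℂ)).symm :
            (n → ℂ) →ₗ[ℂ] EuclideanSpace ℂ n)) * gibbsWeight β (H + (κ : ℂ) • Y)).trace.re) ≤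
      Real.log (projMatrix (K.map ((WithLp.linearEquiv 2 ℂ (n → ℂ)).symm :
          (n → ℂ) →ₗ[ℂ] EuclideanSpace ℂ n)) * gibbsWeight β H).trace.re -
        Real.log (projMatrix (K.map ((WithLp.linearEquiv 2 ℂ (n → ℂ)).symm :
          (n → ℂ) →ₗ[ℂ] EuclideanSpace ℂ n)) * gibbsWeight β (H + (κ : ℂ) • Y)).trace.re := by
  set P := projMatrix (K.map ((WithLp.linearEquiv 2 ℂ (n → ℂ)).symm :
    (n → ℂ) →ₗ[ℂ] EuclideanSpace ℂ n)) with hP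
  have hXh : (H + (κ : ℂ) • Y).IsHermitian :=
    hH.add (hY.smul (by rw [isSelfAdjoint_iff, Complex.star_def, Complex.conj_ofReal]))
  -- `Z_K(H + κY) > 0`: a unit vector of `K` contributes `e^{-β⟨·⟩} > 0`
  obtain ⟨v, hvK, hv0⟩ := (Submodule.ne_bot_iff K).1 hK
  obtain ⟨a, -, hunit⟩ := exists_smul_unit hv0
  have hmem : a • v ∈ K := K.smul_mem a hvK
  have hZpos : 0 < (P * gibbsWeight β (H + (κ : ℂ) • Y)).trace.re :=
    (Real.exp_pos _).trans_le ((exp_neg_mul_rayleigh_le_re_gibbsWeight hXh β hunit).trans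
      (re_rayleigh_le_re_trace_projMatrix_mul (posDef_gibbsWeight β hXh).posSemidef K hmem hunit))
  have h := sectorPartitionFn_mul_exp_le hH hY K hinvH hinvY κ β
  have h2 := Real.log_le_log (mul_pos hZpos (Real.exp_pos _)) h
  rw [Real.log_mul hZpos.ne' (Real.exp_pos _).ne', Real.log_exp] at h2
  linarith

/-- **EVERY SECTOR GROUND STATE FROM THE THERMAL AVERAGE OF THE PENALISED ENSEMBLE.** `H`, `Y`
Hermitian, `K` invariant under both, `ψ ∈ K` a normalised sector ground state of `H`
(`H ψ = minEnergyOn H K • ψ`), `κ, β > 0`. Then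
`⟨Y⟩_{β,K,H+κY} - log (dim K) / (βκ) ≤ re ⟨ψ, Y ψ⟩`:
the sector Gibbs average of `Y` in the PENALISED ensemble `H + κY`, at any inverse temperature with
`βκ` large against the entropy budget `log dim K`, bounds the `Y`-content of every ground state of
`H` from below (`mul_sectorGibbsAverage_le_log_sub_log` + `thermalChord_le_re_rayleigh`).
Degeneracy-blind; no genericity; no `β → ∞`. B. Simon (1993) §II.13; Griffiths (1964) §III.
[folklore] -/
theorem sectorGibbsAverage_sub_le_re_rayleigh_ground {H Y : Matrix n n ℂ} (hH : H.IsHermitian)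
    (hY : Y.IsHermitian) (K : Submodule ℂ (n → ℂ)) (hinvH : ∀ v ∈ K, H *ᵥ v ∈ K)
    (hinvY : ∀ v ∈ K, Y *ᵥ v ∈ K) {ψ : n → ℂ} (hψK : ψ ∈ K) (hψ : star ψ ⬝ᵥ ψ = 1)
    (hHψ : H *ᵥ ψ = ((H.minEnergyOn K : ℝ) : ℂ) • ψ) {κ β : ℝ} (hκ : 0 < κ) (hβ : 0 < β) :
    (projMatrix (K.map ((WithLp.linearEquiv 2 ℂ (n → ℂ)).symm :
          (n → ℂ) →ₗ[ℂ] EuclideanSpace ℂ n)) * gibbsWeight β (H + (κ : ℂ) • Y) * Y).trace.re /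
        (projMatrix (K.map ((WithLp.linearEquiv 2 ℂ (n → ℂ)).symm :
          (n → ℂ) →ₗ[ℂ] EuclideanSpace ℂ n)) * gibbsWeight β (H + (κ : ℂ) • Y)).trace.re -
        Real.log (Module.finrank ℂ K) / (β * κ) ≤
      (star ψ ⬝ᵥ Y *ᵥ ψ).re := by
  have hK : K ≠ ⊥ := by
    intro hbot
    rw [hbot, Submodule.mem_bot] at hψK
    rw [hψK] at hψ
    simp at hψ
  have h1 := mul_sectorGibbsAverage_le_log_sub_log hH hY K hK hinvH hinvY κ β
  have h2 := thermalChord_le_re_rayleigh hH hY K hinvH hψK hψ hHψ hκ hβ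
  have hβκ : 0 < β * κ := mul_pos hβ hκ
  refine le_trans ?_ h2
  rw [sub_div, le_sub_iff_add_le, sub_add_cancel, le_div_iff₀ hβκ]
  linarith

/-- **Registered form** (sub-goal `penalisedThermalAverageForcesEveryGround` of item
`stmt-HubbardSuperconductivity-2083`): `sectorGibbsAverage_sub_le_re_rayleigh_ground` as a closed
proposition over `n : Type`. [folklore] -/
theorem penalisedThermalAverageForcesEveryGround : ∀ {n : Type} [Fintype n] [DecidableEq n] (H Y : Matrix n n ℂ), H.IsHermitian → Y.IsHermitian → ∀ (K : Submodule ℂ (n → ℂ)), (∀ v ∈ K, H *ᵥ v ∈ K) → (∀ v ∈ K, Y *ᵥ v ∈ K) → ∀ (ψ : n → ℂ), ψ ∈ K → star ψ ⬝ᵥ ψ = 1 → H *ᵥ ψ = ((H.minEnergyOn K : ℝ) : ℂ) • ψ → ∀ (κ β : ℝ), 0 < κ → 0 < β → (Literature.MathematicalPhysics.QuantumLattice.projMatrix (K.map ((WithLp.linearEquiv 2 ℂ (n → ℂ)).symm : (n → ℂ) →ₗ[ℂ] EuclideanSpace ℂ n)) * Matrix.gibbsWeight β (H + (κ : ℂ)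 • Y) * Y).trace.re / (Literature.MathematicalPhysics.QuantumLattice.projMatrix (K.map ((WithLp.linearEquiv 2 ℂ (n → ℂ)).symm : (n → ℂ) →ₗ[ℂ] EuclideanSpace ℂ n)) * Matrix.gibbsWeight β (H + (κ : ℂ) • Y)).trace.re - Real.log (Module.finrank ℂ K) / (β * κ) ≤ (star ψ ⬝ᵥ Y *ᵥ ψ).re :=
  fun _ _ hH hY K hinvH hinvY _ hψK hψ hHψ _ _ hκ hβ =>
    sectorGibbsAverage_sub_le_re_rayleigh_ground hH hY K hinvH hinvY hψK hψ hHψ hκ hβ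

end Abstract

end Summit.HubbardSuperconductivity.HubbardSuperconductivity.Theorems
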